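/-
Copyright (c) 2026 the pub-hodgecm-mathlib formalisation cell (harness21).  Prover seat hodgecm-mathlib-K2E4-p10 (g5), Track B ∕ K2-LIT, h413 =
`stmt-HodgeConjecture-24833`, ENGINE E1, campaign «EIS-WHITTAKER-3», deal D-W1 «W2₃-fin-inert» of the dealer K2E1-plan (g5) (DEALS MEMO
`K2/K2E1-plan/g5/DEALS-EIS-WHITTAKER-3-wave1.K2E1-plan-g5.md` fe56b7cd5d935977 §D-W1, RULING 08:09:42Z): the finite Whittaker local factor of the spherical flat section of
`U(2,1)_{L∕L⁺}` at an INERT UNRAMIFIED place — a rank-one reduction onto ★ W2-fin.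
-/
import Summits.HodgeConjecture.HodgeConjecture.Theorems.K2E1IntertwiningLocalFactorU3   -- ★ p858482 (K2E2-p12 g5): `exists_normAbs_eq_of_residueFieldCard_eq_sq`, `integral_integral_inertCell_eq_prod ∕ _eq` (untwisted, real); brings ★ GK `GL₃`, ★ `K2E1IntertwiningLocalFactorU2`, ★ `K2LiuGKRankOneIntegral`
import Summits.HodgeConjecture.HodgeConjecture.Theorems.K2E1FiniteWhittakerPolynomial    -- ★ p858310 (K2-defs1 g4): W2-fin `integral_weight_mul_addChar_eq_closedForm ∕ _eq_zero_of_not_mem ∕ _of_conductor_zero_of_normAbs_eq_one ∕ _eq_zero_of_one_lt_normAbs`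
import HarnessLib

/-!
# K2·E1 — `K2E1FiniteWhittakerInertU3` (D-W1 «W2₃-fin-inert»): THE FINITE WHITTAKER LOCAL FACTOR OF THE SPHERICAL SECTION OF `U(2,1)` AT AN INERT UNRAMIFIED PLACE
# `J_v(ξ, s) = ∫_{L_w} [∫_{L⁺_v} max(1, ‖X‖_w, |t|_v)^{−2s} dt] ψ_w(Xξ) dX = G_{L⁺_v}(2s) · P_w(ξ; 2s − 1)` — UNIT VALUE `μμ′·(1 − q^{−2s})(1 + q^{−(2s−1)})`

Track B ∕ K2-LIT, crux h413 = `stmt-HodgeConjecture-24833`, route of record `HCCMUnconditional`; cell `hodgecm-mathlib`, squad K2, ENGINE E1 (campaign «EIS-WHITTAKER-3», spec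
of record = K2E1b-plan (g6) CENSUS `CENSUS-EIS-WHITTAKER-3.K2E1b-plan-g6.md` ba907189b20ed180 §2 «FINITE, INERT UNRAMIFIED»).  Deal D-W1 of K2E1-plan (g5); prover seat
`hodgecm-mathlib-K2E4-p10` (g5).  THEOREMS ONLY (no `def`, no `instance`, no notation, no named-fact hypothesis, no `sorry`; default heartbeats); lane
`--supports stmt-HodgeConjecture-24833 --as helper` (count-neutral).  Closes no socket.  CURRENCY = ★ (q10) FILE 2 §2's (the dealer's default): TWO non-archimedean local
fields `E ⊇ F` (`= (L_w, L⁺_v)`) with `q_E = q_F²` (inert unramified), any additive Haar measures `μE`, `μF`, `‖·‖ = normAbs`, COMPLEX `s` (the flat-section parameter of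
E1's `H^s`), the weight in ★ W2-fin's bytes `(((max 1 … : ℝ) : ℝ) : ℂ) ^ (−(2·))`, a continuous additive character `ψ : AddChar E Circle` of conductor exponent `m`, Tate's
order `ψ(X·ξ)`, ITERATED Bochner integrals.

THE MATHEMATICS [Casselman1980, §3 Thm. 3.1; Tate1950, §2.2 Lemma 2.2.5, §2.5; Gelbart–Piatetski-Shapiro 1984 (4.5); Rogawski1990, §4.5 p. 45].  Along the big-cell Heisenberg chart of
`U(J₃) = U(2,1)` the finite height factor of the flat spherical section at an inert unramified `v` (`w ∣ v`, `q_w = q_v²`) is `max(1, ‖X‖_w, |t|_v)^{−2s}` (★ (q10) FILE 2: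
rank-one reduction), so the `ξ`-th ABELIAN WHITTAKER local factor (character `ψ_w(Xξ)` of `N∕Z ≅ L_w`, trivial on the centre variable `t`) is
  `J_v(ξ, s) := ∫_{L_w} (∫_{L⁺_v} max(1, ‖X‖_w, |t|_v)^{−2s} dt) ψ_w(Xξ) dX`.
The inner `t`-integral has the FLOOR `‖X‖_w ∈ q_v^{2ℤ} ⊆ |L⁺_v|` and equals `max(1, ‖X‖_w)^{1−2s} · G_{L⁺_v}(2s)` (§1, Tate's substitution — the complex-exponent twin of ★ GK
`GL₃` `integral_max_one_max_normAbs_rpow_neg`), `G_F(z) = ∫_F max(1,|t|)^{−z} dt = μ(𝒪_F)(1 − q^{−z})∕(1 − q^{1−z})` (★ `K2LiuGKRankOneIntegral`); hence (§2, EVERY complex `s`,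
unconditionally)
  **`J_v(ξ, s) = G_{L⁺_v}(2s) · P_w(ξ; s − ½)`,  `P_w(ξ; z) := ∫_{L_w} max(1, ‖X‖_w)^{−2z} ψ_w(Xξ) dX`** = ★ W2-fin's polynomial BY NAME at the field `L_w` and index `z = s − ½`
(weight exponent `2s − 1`).  On the window `Re s > 1` (⇔ `Re z > ½`) ★ W2-fin gives the closed form: for `ξ ∈ 𝔭_w^{m+n} ∖ 𝔭_w^{m+n+1}`
  **`J_v(ξ, s) = μ(𝒪_v) μ(𝒪_w) · (1 − q^{−2s})(1 + q^{−(2s−1)}) · Σ_{k=0}^{n} (q_w^{−(2s−1)}·q_w)^k`**  (`q = q_v`, `q_w = q²`: the factor `(1 − q_w^{−(2s−1)}) = (1 − q^{−(2s−1)})(1 + q^{−(2s−1)})`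
of `P_w` CANCELS the denominator of `G_{L⁺_v}(2s)` — a POLYNOMIAL in `q^{−s}`, ENTIRE in `s`), `J_v(ξ, s) = 0` for `ξ ∉ 𝔭_w^m`; at conductor `𝒪_w` and `‖ξ‖_w = 1`:
  **`J_v(unit ξ, s) = μ(𝒪_v) μ(𝒪_w) · (1 − q^{−2s})(1 + q^{−(2s−1)}) = μμ′ · (1 − q^{−s})(1 − ε q^{−s})(1 − ε q^{−(2s−1)})` at `ε = −1`** — LITERALLY the local DENOMINATOR of ★
`K2E1IntertwiningScalarContinuationU3.hasProd_localScalar_three` at an inert place (`[ζ_{L,w}(s)·L_v(2s−1, ε_{L∕L⁺})]⁻¹`, `ε_v = −1`; the census's cheapest falsifier ✓), and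
`J_v(ξ, s) = 0` for `‖ξ‖_w > 1`.  TRIVIAL BOUND (§5, `|ψ| = 1`): `‖J_v(ξ, s)‖ ≤ G_{L⁺_v}(2σ)·G_{L_w}(2σ−1) = ∫∫ max(1, ‖X‖_w, |t|_v)^{−2σ}` at `σ = Re s > 1` — the UNTWISTED inert
scalar ★ `integral_integral_inertCell_eq` (uniform in `ξ`, the W4₃ majorant).  HOLOMORPHY (§6): `s ↦ J_v(ξ, s)` is holomorphic on `{1 < Re s}` (indeed agrees there with an
entire function), for `ξ` in a shell and for `ξ ∉ 𝔭_w^m`.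
CONSISTENCY (not an input): Gelbart–Piatetski-Shapiro (LNM 1041, 1984) (4.5)(iii) class-1 Whittaker function `W(diag(ϖⁿ,1,ϖ⁻ⁿ))` = our `J_v(ξ)∕J_v(unit)` as a function of `n = ord_w ξ` after
`d(δ)`-covariance and `δ_B^{1∕2}`.

WHAT IS PROVED (generic `E`, `F`; `q_E = q_F²` where said):
* §1 `integral_max_one_max_normAbs_cpow_neg` (complex floor lemma over ONE field, all `z : F`, all `w : ℂ`), `integral_max_one_max_cpow_neg_of_sq` (floor `‖X‖_E`, `q_E = q_F²`).
* §2 **`integral_inertWhittaker_eq_mul`** — `J(ξ, s) = G_F(2s) · P_E(ξ; s − ½)` for EVERY `s : ℂ`, every `ψ`, every `ξ` (integrability-free).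
* §3 **`integral_inertWhittaker_eq_closedForm`** (`1 < Re s`, shell `n`), `integral_inertWhittaker_eq_zero_of_not_mem` (`ξ ∉ 𝔭_E^m`).
* §4 **`integral_inertWhittaker_eq_of_conductor_zero_of_normAbs_eq_one`** (UNIT VALUE), `…_eq_localDen` (FILE 1's token shape at `ε = −1`), `integral_inertWhittaker_eq_zero_of_one_lt_normAbs`.
* §5 `norm_integral_max_one_cpow_le` (`‖G_F(2s)‖ ≤ G_F(2σ)`), `norm_integral_weight_mul_addChar_le` (`‖P_E‖ ≤ G_E(2σ−1)`), **`norm_integral_inertWhittaker_le`** (trivial bound by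
  the untwisted inert scalar), `norm_integral_inertWhittaker_le_closedForm` (closed form at `σ = Re s`).
* §6 `differentiable_inertWhittakerClosedForm`, **`differentiableOn_integral_inertWhittaker`** (shell), `differentiableOn_integral_inertWhittaker_of_not_mem`.
HONEST LABEL: HC_CM is proved only modulo the 7 printed citations (2 remaining named inputs: hLiu418 = `stmt-HodgeConjecture-24832`, h413 = `stmt-HodgeConjecture-24833`) until rung 0
closes; this file asserts no named fact and closes no socket; count-neutral.

## References
* [Casselman1980] W. Casselman, *The unramified principal series of p-adic groups I*, Compositio Math. 40 (1980): §3, Thm. 3.1.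
* [Tate1950] J. Tate, *Fourier analysis in number fields and Hecke's zeta-functions* (1950): §2.2 Lemma 2.2.5, §2.5.
* (consistency check only, no bib key) S. Gelbart, I. Piatetski-Shapiro, *Automorphic forms and L-functions for the unitary group*, in LNM 1041 (1984): (2.1), (4.5).
* [Rogawski1990] J. D. Rogawski, *Automorphic Representations of Unitary Groups in Three Variables* (1990): §4.5 p. 45.
-/

set_option autoImplicit false
set_option linter.dupNamespace false -- the mandated namespace repeats `HodgeConjecture.HodgeConjecture`

noncomputable section

open MeasureTheory Filter Topology Set
open scoped NNReal ENNReal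
open Literature.NumberTheory.GaloisRepresentations.IsNonarchimedeanLocalField
open Literature.NumberTheory.Automorphic Literature.NumberTheory.Automorphic.LocalFieldHaar
open Summit.HodgeConjecture.HodgeConjecture.Cruxes.HLiu418.K2LiuGKRankOneIntegral (one_lt_residueFieldCard_real ofReal_pow_cpow)
open Summit.HodgeConjecture.HodgeConjecture.Cruxes.H413.K2E1IntertwiningLocalFactorU2 (integrable_and_integral_max_one_normAbs_cpow_two_mul
  integrable_max_one_normAbs_rpow_neg)
open Summit.HodgeConjecture.HodgeConjecture.Cruxes.H413.K2E1GindikinKarpelevichSplitGL3 (max_one_max_eq_mul max_one_max_eq_of_le_one)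
open Summit.HodgeConjecture.HodgeConjecture.Cruxes.H413.K2E1IntertwiningLocalFactorU3 (exists_normAbs_eq_of_residueFieldCard_eq_sq
  integral_integral_inertCell_eq_prod integral_integral_inertCell_eq)
open Summit.HodgeConjecture.HodgeConjecture.Cruxes.H413.K2E1FiniteWhittakerPolynomial

namespace Summit.HodgeConjecture.HodgeConjecture.Cruxes.H413.K2E1FiniteWhittakerInertU3

/-! ## §0 Complex bookkeeping: the datum `u = q^{−(2s−1)}` on the window -/

/-- `‖q^{−w}‖ < 1` for a natural number `q > 1` and `Re w > 0`. [folklore] -/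
theorem norm_natCast_cpow_neg_lt_one {q : ℕ} (hq : 1 < q) {w : ℂ} (hw : 0 < w.re) : ‖(q : ℂ) ^ (-w)‖ < 1 := by
  have hq1 : (1 : ℝ) < (q : ℝ) := by exact_mod_cast hq
  rw [Complex.norm_natCast_cpow_of_pos (zero_lt_one.trans hq), Complex.neg_re]
  exact Real.rpow_lt_one_of_one_lt_of_neg hq1 (by linarith)

/-- `1 − q^{−w} ≠ 0` for `q > 1`, `Re w > 0`. [folklore] -/
theorem one_sub_natCast_cpow_neg_ne_zero {q : ℕ} (hq : 1 < q) {w : ℂ} (hw : 0 < w.re) : (1 : ℂ) - (q : ℂ) ^ (-w) ≠ 0 := by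
  intro h
  have h1 : ‖(q : ℂ) ^ (-w)‖ = 1 := by rw [← sub_eq_zero.1 h, norm_one]
  exact (norm_natCast_cpow_neg_lt_one hq hw).ne h1

/-- `Re (s − ½) = Re s − ½`. [folklore] -/
theorem re_sub_half (s : ℂ) : (s - 1 / 2).re = s.re - 1 / 2 := by
  rw [show (1 / 2 : ℂ) = ((1 / 2 : ℝ) : ℂ) by push_cast; ring, Complex.sub_re, Complex.ofReal_re]

section TwoLocalFields

variable {E F : Type*} [Field E] [ValuativeRel E] [TopologicalSpace E] [IsNonarchimedeanLocalField E]
  [Field F] [ValuativeRel F] [TopologicalSpace F] [IsNonarchimedeanLocalField F]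

/-- `q_E^{w} = (q_F^{w})²` when `q_E = q_F²` (positive real base, no branch issue: ★ `ofReal_pow_cpow`). [folklore] -/
theorem residueFieldCard_cpow_of_sq (hq : residueFieldCard E = residueFieldCard F ^ 2) (w : ℂ) :
    (residueFieldCard E : ℂ) ^ w = ((residueFieldCard F : ℂ) ^ w) ^ 2 := by
  rw [← ofReal_pow_cpow (F := F) 2 w, hq]
  push_cast
  ring_nf

variable [MeasurableSpace F] [BorelSpace F] (μF : Measure F) [μF.IsAddHaarMeasure]

/-! ## §1 The floor lemma with a COMPLEX exponent -/

/-- **`∫_F max(1,|z|,|t|)^{−w} dμ(t) = max(1,|z|)^{1−w} · ∫_F max(1,|t|)^{−w} dμ(t)`** for every `z : F` and every COMPLEX `w` (unconditional identity of Bochner integrals; the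
complex-exponent twin of ★ GK `GL₃` `integral_max_one_max_normAbs_rpow_neg`): trivial for `|z| ≤ 1`; for `|z| > 1` substitute `t = z·u` (★ `integral_comp_mul_left`, Jacobian `|z|`)
and use `max(1,|z|,|z||u|) = |z|·max(1,|u|)` (★ `max_one_max_eq_mul`). [cite: Tate1950, §2.2 Lemma 2.2.5] [cite: Casselman1980, Thm. 3.1] -/
theorem integral_max_one_max_normAbs_cpow_neg (z : F) (w : ℂ) :
    ∫ t, (((max 1 (max ((normAbs F z : ℝ≥0) : ℝ) ((normAbs F t : ℝ≥0) : ℝ)) : ℝ) : ℂ) ^ (-w)) ∂μF =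
      (((max 1 ((normAbs F z : ℝ≥0) : ℝ)) : ℝ) : ℂ) ^ (1 - w) * ∫ t, (((max 1 ((normAbs F t : ℝ≥0) : ℝ) : ℝ) : ℂ) ^ (-w)) ∂μF := by
  rcases le_or_gt (normAbs F z) 1 with hz | hz
  · have hz' : ((normAbs F z : ℝ≥0) : ℝ) ≤ 1 := by exact_mod_cast hz
    simp_rw [max_one_max_eq_of_le_one hz']
    rw [max_eq_left hz', Complex.ofReal_one, Complex.one_cpow, one_mul]
  · have hz0 : z ≠ 0 := by
      rintro rfl
      rw [map_zero] at hz
      exact not_lt.2 zero_le_one hz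
    have hzR : (1 : ℝ) < ((normAbs F z : ℝ≥0) : ℝ) := by exact_mod_cast hz
    have hzpos : (0 : ℝ) < ((normAbs F z : ℝ≥0) : ℝ) := one_pos.trans hzR
    have hzC : (((normAbs F z : ℝ≥0) : ℝ) : ℂ) ≠ 0 := by exact_mod_cast hzpos.ne'
    have hsub := integral_comp_mul_left μF hz0
      (fun t => (((max 1 (max ((normAbs F z : ℝ≥0) : ℝ) ((normAbs F t : ℝ≥0) : ℝ)) : ℝ) : ℂ) ^ (-w)))
    have hinv : ((normAbs F z⁻¹ : ℝ≥0) : ℝ) = ((normAbs F z : ℝ≥0) : ℝ)⁻¹ := by rw [map_inv₀, NNReal.coe_inv]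
    have hpt : ∀ u : F, (((max 1 (max ((normAbs F z : ℝ≥0) : ℝ) ((normAbs F (z * u) : ℝ≥0) : ℝ)) : ℝ) : ℂ) ^ (-w)) =
        (((normAbs F z : ℝ≥0) : ℝ) : ℂ) ^ (-w) * (((max 1 ((normAbs F u : ℝ≥0) : ℝ) : ℝ) : ℂ) ^ (-w)) := by
      intro u
      rw [map_mul, NNReal.coe_mul, max_one_max_eq_mul hzR.le _, inv_mul_cancel_left₀ hzpos.ne', Complex.ofReal_mul,
        Complex.mul_cpow_ofReal_nonneg hzpos.le (le_trans zero_le_one (le_max_left _ _))]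
    simp only [hpt, hinv] at hsub
    rw [integral_const_mul, Complex.real_smul, Complex.ofReal_inv, eq_comm, inv_mul_eq_iff_eq_mul₀ hzC] at hsub
    rw [hsub, max_eq_right hzR.le, ← mul_assoc, sub_eq_add_neg, Complex.cpow_add _ _ hzC, Complex.cpow_one]

/-- **THE FLOOR LEMMA WITH FLOOR `‖X‖_E`** (`q_E = q_F²`, every complex `w`): `∫_F max(1, ‖X‖_E, |t|_F)^{−w} dμ_F = max(1, ‖X‖_E)^{1−w} · ∫_F max(1, |t|_F)^{−w} dμ_F` — §1 at a
`z ∈ F` with `|z|_F = ‖X‖_E` (★ `exists_normAbs_eq_of_residueFieldCard_eq_sq`: `‖X‖_E ∈ q_F^{2ℤ}` is a value of `|·|_F`). [cite: Tate1950, §2.2 Lemma 2.2.5] [cite: Casselman1980, Thm. 3.1] -/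
theorem integral_max_one_max_cpow_neg_of_sq (hq : residueFieldCard E = residueFieldCard F ^ 2) (X : E) (w : ℂ) :
    ∫ t, (((max 1 (max ((normAbs E X : ℝ≥0) : ℝ) ((normAbs F t : ℝ≥0) : ℝ)) : ℝ) : ℂ) ^ (-w)) ∂μF =
      (((max 1 ((normAbs E X : ℝ≥0) : ℝ)) : ℝ) : ℂ) ^ (1 - w) * ∫ t, (((max 1 ((normAbs F t : ℝ≥0) : ℝ) : ℝ) : ℂ) ^ (-w)) ∂μF := by
  obtain ⟨z, hz⟩ := exists_normAbs_eq_of_residueFieldCard_eq_sq hq X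
  rw [← hz]
  exact integral_max_one_max_normAbs_cpow_neg μF z w

variable [MeasurableSpace E] [BorelSpace E] (μE : Measure E) [μE.IsAddHaarMeasure]

/-! ## §2 The rank-one reduction: `J(ξ, s) = G_F(2s) · P_E(ξ; s − ½)` for every complex `s` -/

omit [BorelSpace E] [μE.IsAddHaarMeasure] in
/-- **INERT WHITTAKER FACTOR = `G_F(2s)` × W2-fin POLYNOMIAL OVER `E` AT INDEX `s − ½`** (`q_E = q_F²`; EVERY complex `s`, every character `ψ`, every frequency `ξ`; iterated
Bochner integrals, integrability-free):
`∫_E (∫_F max(1, ‖X‖_E, |t|_F)^{−2s} dμ_F) ψ(Xξ) dμ_E = (∫_F max(1,|t|)^{−2s} dμ_F) · ∫_E max(1, ‖X‖_E)^{−2(s−½)} ψ(Xξ) dμ_E` — the right-hand `E`-integral is ★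
`K2E1FiniteWhittakerPolynomial`'s integrand VERBATIM at the field `E` and `z = s − ½`. [cite: Casselman1980, §3 Thm. 3.1] [cite: Rogawski1990, §4.5 p. 45] -/
theorem integral_inertWhittaker_eq_mul (hq : residueFieldCard E = residueFieldCard F ^ 2) (ψ : AddChar E Circle) (ξ : E) (s : ℂ) :
    ∫ X, (∫ t, (((max 1 (max ((normAbs E X : ℝ≥0) : ℝ) ((normAbs F t : ℝ≥0) : ℝ)) : ℝ) : ℂ) ^ (-(2 * s))) ∂μF) * ((ψ (X * ξ) : Circle) : ℂ) ∂μE =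
      (∫ t, (((max 1 ((normAbs F t : ℝ≥0) : ℝ) : ℝ) : ℂ) ^ (-(2 * s))) ∂μF) *
        ∫ X, (((max 1 ((normAbs E X : ℝ≥0) : ℝ) : ℝ) : ℂ) ^ (-(2 * (s - 1 / 2)))) * ((ψ (X * ξ) : Circle) : ℂ) ∂μE := by
  simp_rw [integral_max_one_max_cpow_neg_of_sq μF hq _ (2 * s)]
  rw [← integral_const_mul]
  refine integral_congr_ae (Filter.Eventually.of_forall fun X => ?_)
  simp only
  rw [show (1 : ℂ) - 2 * s = -(2 * (s - 1 / 2)) by ring]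
  ring

/-! ## §3 Closed form on the window `Re s > 1` (★ W2-fin at `z = s − ½`, `Re z > ½`) -/

/-- **CLOSED FORM ON THE WINDOW** (`q_E = q_F²`, `ψ` continuous of conductor exponent `m`, `ξ ∈ 𝔭_E^{m+n} ∖ 𝔭_E^{m+n+1}`, `1 < Re s`): with `q = q_F`, `q_E = q²`,
`J(ξ, s) = μ_F(𝒪_F) μ_E(𝒪_E) · (1 − q^{−2s})(1 + q^{−(2s−1)}) · Σ_{k=0}^{n} (q_E^{−(2s−1)}·q_E)^k` — ★ `K2LiuGKRankOneIntegral` for `G_F(2s) = μ(1 − q^{−2s})(1 − q^{−(2s−1)})⁻¹` and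
★ W2-fin `integral_weight_mul_addChar_eq_closedForm` for `P_E(ξ; s−½) = μ′(1 − q_E^{−(2s−1)}) Σ_k (…)^k`; the factor `1 − q_E^{−(2s−1)} = (1 − q^{−(2s−1)})(1 + q^{−(2s−1)})` cancels the
denominator — a POLYNOMIAL in `q^{−s}`. [cite: Casselman1980, §3 Thm. 3.1] [cite: Tate1950, §2.5] -/
theorem integral_inertWhittaker_eq_closedForm (hq : residueFieldCard E = residueFieldCard F ^ 2) {ψ : AddChar E Circle} (hψ : Continuous ψ) {m : ℤ}
    (hm : ψ.HasConductorExp m) {ξ : E} {n : ℕ} (hn : ξ ∈ primePowBall E (m + n)) (hn' : ξ ∉ primePowBall E (m + n + 1)) {s : ℂ} (hs : 1 < s.re) :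
    ∫ X, (∫ t, (((max 1 (max ((normAbs E X : ℝ≥0) : ℝ) ((normAbs F t : ℝ≥0) : ℝ)) : ℝ) : ℂ) ^ (-(2 * s))) ∂μF) * ((ψ (X * ξ) : Circle) : ℂ) ∂μE =
      (μF.real (primePowBall F 0) : ℂ) * (μE.real (primePowBall E 0) : ℂ) *
        ((1 - (residueFieldCard F : ℂ) ^ (-(2 * s))) * (1 + (residueFieldCard F : ℂ) ^ (-(2 * s - 1))) *
          ∑ k ∈ Finset.range (n + 1), ((residueFieldCard E : ℂ) ^ (-(2 * s - 1)) * (residueFieldCard E : ℂ)) ^ k) := by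
  have hs' : 1 / 2 < s.re := by linarith
  have hz : 1 / 2 < (s - 1 / 2).re := by rw [re_sub_half]; linarith
  have h1 : (1 : ℂ) - (residueFieldCard F : ℂ) ^ (-(2 * s - 1)) ≠ 0 :=
    one_sub_natCast_cpow_neg_ne_zero (one_lt_residueFieldCard F) (by rw [Complex.sub_re, Complex.mul_re]; simp; linarith)
  rw [integral_inertWhittaker_eq_mul μF μE hq ψ ξ s, (integrable_and_integral_max_one_normAbs_cpow_two_mul μF hs').2,
    integral_weight_mul_addChar_eq_closedForm μE hψ hm hn hn' hz, show (2 : ℂ) * (s - 1 / 2) = 2 * s - 1 by ring]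
  -- cancel `(1 − q^{−(2s−1)})⁻¹` against `1 − q_E^{−(2s−1)} = (1 − q^{−(2s−1)})(1 + q^{−(2s−1)})`
  have hfac : (1 : ℂ) - (residueFieldCard E : ℂ) ^ (-(2 * s - 1)) =
      (1 - (residueFieldCard F : ℂ) ^ (-(2 * s - 1))) * (1 + (residueFieldCard F : ℂ) ^ (-(2 * s - 1))) := by
    rw [residueFieldCard_cpow_of_sq hq]; ring
  rw [hfac]
  field_simp

/-- **VANISHING OUTSIDE `𝔭_E^m`** (`1 < Re s`): if `ξ ∉ 𝔭_E^m` then `J(ξ, s) = 0` (★ W2-fin `integral_weight_mul_addChar_eq_zero_of_not_mem` at `z = s − ½`) — the support of the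
Whittaker coefficient in the frequency. [cite: Tate1950, §2.5] [cite: Casselman1980, §3] -/
theorem integral_inertWhittaker_eq_zero_of_not_mem (hq : residueFieldCard E = residueFieldCard F ^ 2) {ψ : AddChar E Circle} (hψ : Continuous ψ) {m : ℤ}
    (hm : ψ.HasConductorExp m) {ξ : E} (hξ : ξ ∉ primePowBall E m) {s : ℂ} (hs : 1 < s.re) :
    ∫ X, (∫ t, (((max 1 (max ((normAbs E X : ℝ≥0) : ℝ) ((normAbs F t : ℝ≥0) : ℝ)) : ℝ) : ℂ) ^ (-(2 * s))) ∂μF) * ((ψ (X * ξ) : Circle) : ℂ) ∂μE = 0 := by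
  have hz : 1 / 2 < (s - 1 / 2).re := by rw [re_sub_half]; linarith
  rw [integral_inertWhittaker_eq_mul μF μE hq ψ ξ s, integral_weight_mul_addChar_eq_zero_of_not_mem μE hψ hm hξ hz, mul_zero]

/-! ## §4 Conductor `𝒪_E`: the UNIT VALUE and the support `‖ξ‖_E ≤ 1` -/

/-- **THE UNIT VALUE** (`q_E = q_F²`, `ψ` of conductor `𝒪_E`, `‖ξ‖_E = 1`, `1 < Re s`): `J(unit ξ, s) = μ_F(𝒪_F) μ_E(𝒪_E) · (1 − q^{−2s})(1 + q^{−(2s−1)})`, `q = q_F`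
(`G_F(2s)·μ′(1 − q_E^{−(2s−1)})` with `q_E = q²`) — `= μμ′·[ζ_E(s)·L_F(2s−1, ω)]⁻¹`, `ζ_E(s) = (1−q^{−2s})⁻¹`, `L(s, ω) = (1 + q^{−s})⁻¹` (`ω = −1`).
[cite: Casselman1980, §3 Thm. 3.1] [cite: Rogawski1990, §4.5 p. 45] -/
theorem integral_inertWhittaker_eq_of_conductor_zero_of_normAbs_eq_one (hq : residueFieldCard E = residueFieldCard F ^ 2) {ψ : AddChar E Circle}
    (hψ : Continuous ψ) (h0 : ψ.HasConductorExp 0) {ξ : E} (hξ : normAbs E ξ = 1) {s : ℂ} (hs : 1 < s.re) :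
    ∫ X, (∫ t, (((max 1 (max ((normAbs E X : ℝ≥0) : ℝ) ((normAbs F t : ℝ≥0) : ℝ)) : ℝ) : ℂ) ^ (-(2 * s))) ∂μF) * ((ψ (X * ξ) : Circle) : ℂ) ∂μE =
      (μF.real (primePowBall F 0) : ℂ) * (μE.real (primePowBall E 0) : ℂ) *
        ((1 - (residueFieldCard F : ℂ) ^ (-(2 * s))) * (1 + (residueFieldCard F : ℂ) ^ (-(2 * s - 1)))) := by
  have hn : ξ ∈ primePowBall E (0 + (0 : ℕ)) := by
    rw [mem_primePowBall_iff, hξ, Nat.cast_zero, add_zero, zpow_zero]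
  have hn' : ξ ∉ primePowBall E (0 + (0 : ℕ) + 1) := by
    rw [mem_primePowBall_iff, hξ, Nat.cast_zero, add_zero, zero_add, zpow_one, not_le]
    exact inv_residueFieldCard_lt_one
  rw [integral_inertWhittaker_eq_closedForm μF μE hq hψ h0 hn hn' hs, Finset.sum_range_one, pow_zero, mul_one]

/-- **THE UNIT VALUE IN FILE 1's TOKENS**: `= μ_F(𝒪_F) μ_E(𝒪_E) · (1 − q^{−s})(1 − ε q^{−s})(1 − ε q^{−(2s−1)})` at `ε = −1` — VERBATIM the `v`-DENOMINATOR of ★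
`K2E1IntertwiningScalarContinuationU3.hasProd_localScalar_three` at an inert place (`ε_v = ε_{L∕L⁺}(ϖ_v) = −1`), whose product over `v ∉ S_ξ` is
`ζ^{S_ξ}_L(s)·L^{S_ξ}(2s−1, ε_{L∕L⁺})` restricted to the inert places. [cite: Rogawski1990, §4.5 p. 45] -/
theorem integral_inertWhittaker_eq_localDen (hq : residueFieldCard E = residueFieldCard F ^ 2) {ψ : AddChar E Circle}
    (hψ : Continuous ψ) (h0 : ψ.HasConductorExp 0) {ξ : E} (hξ : normAbs E ξ = 1) {s : ℂ} (hs : 1 < s.re) :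
    ∫ X, (∫ t, (((max 1 (max ((normAbs E X : ℝ≥0) : ℝ) ((normAbs F t : ℝ≥0) : ℝ)) : ℝ) : ℂ) ^ (-(2 * s))) ∂μF) * ((ψ (X * ξ) : Circle) : ℂ) ∂μE =
      (μF.real (primePowBall F 0) : ℂ) * (μE.real (primePowBall E 0) : ℂ) *
        ((1 - (residueFieldCard F : ℂ) ^ (-s)) * (1 - (-1) * (residueFieldCard F : ℂ) ^ (-s)) * (1 - (-1) * (residueFieldCard F : ℂ) ^ (-(2 * s - 1)))) := by
  have hq0 : (residueFieldCard F : ℂ) ≠ 0 := by exact_mod_cast (zero_lt_one.trans (one_lt_residueFieldCard F)).ne'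
  rw [integral_inertWhittaker_eq_of_conductor_zero_of_normAbs_eq_one μF μE hq hψ h0 hξ hs,
    show (-(2 * s) : ℂ) = -s + -s by ring, Complex.cpow_add _ _ hq0]
  ring

/-- **`‖ξ‖_E > 1` ⇒ `J(ξ, s) = 0`** at conductor `𝒪_E` (`1 < Re s`): the unramified Whittaker coefficient is supported on integral frequencies.
[cite: Casselman1980, §3] [cite: Tate1950, §2.5] -/
theorem integral_inertWhittaker_eq_zero_of_one_lt_normAbs (hq : residueFieldCard E = residueFieldCard F ^ 2) {ψ : AddChar E Circle}
    (hψ : Continuous ψ) (h0 : ψ.HasConductorExp 0) {ξ : E} (hξ : 1 < normAbs E ξ) {s : ℂ} (hs : 1 < s.re) :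
    ∫ X, (∫ t, (((max 1 (max ((normAbs E X : ℝ≥0) : ℝ) ((normAbs F t : ℝ≥0) : ℝ)) : ℝ) : ℂ) ^ (-(2 * s))) ∂μF) * ((ψ (X * ξ) : Circle) : ℂ) ∂μE = 0 := by
  refine integral_inertWhittaker_eq_zero_of_not_mem μF μE hq hψ h0 (fun h => ?_) hs
  rw [mem_primePowBall_iff, zpow_zero] at h
  exact not_lt.2 h hξ

/-! ## §5 The trivial bound: `‖J(ξ, s)‖ ≤` the UNTWISTED inert scalar at `σ = Re s` (uniform in `ξ`, `|ψ| = 1`) -/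

omit [MeasurableSpace F] [BorelSpace F] in
/-- Pointwise: `‖max(1, x)^{−w}‖ = max(1, x)^{−Re w}` (the base is a real number `≥ 1 > 0`). [folklore] -/
theorem norm_max_one_cpow_neg (x : ℝ) (w : ℂ) : ‖(((max 1 x : ℝ) : ℂ) ^ (-w))‖ = (max 1 x) ^ (-w.re) := by
  rw [Complex.norm_cpow_eq_rpow_re_of_pos (lt_of_lt_of_le one_pos (le_max_left 1 x)), Complex.neg_re]

omit [MeasurableSpace F] [BorelSpace F] in
/-- `Re (2s) = 2 Re s` and `Re (2(s − ½)) = 2 Re s − 1`. [folklore] -/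
theorem re_two_mul (s : ℂ) : (2 * s).re = 2 * s.re ∧ (2 * (s - 1 / 2)).re = 2 * s.re - 1 := by
  have h : ∀ w : ℂ, (2 * w).re = 2 * w.re := fun w => by simp [Complex.mul_re]
  refine ⟨h s, ?_⟩
  rw [h, re_sub_half]
  ring

/-- **`‖G_F(2s)‖ ≤ G_F(2σ)`**, `σ = Re s > ½`: `‖∫_F max(1,|t|)^{−2s} dμ_F‖ ≤ ∫_F max(1,|t|)^{−2σ} dμ_F` (★ `integrable_max_one_normAbs_rpow_neg` majorant). [cite: Casselman1980, §3 Thm. 3.1] -/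
theorem norm_integral_max_one_cpow_le {s : ℂ} (hs : 1 / 2 < s.re) :
    ‖∫ t, (((max 1 ((normAbs F t : ℝ≥0) : ℝ) : ℝ) : ℂ) ^ (-(2 * s))) ∂μF‖ ≤ ∫ t, (max 1 ((normAbs F t : ℝ≥0) : ℝ)) ^ (-(2 * s.re)) ∂μF := by
  refine norm_integral_le_of_norm_le (integrable_max_one_normAbs_rpow_neg μF (by linarith : 1 < 2 * s.re))
    (Filter.Eventually.of_forall fun t => ?_)
  rw [norm_max_one_cpow_neg, (re_two_mul s).1]

/-- **`‖P_E(ξ; s − ½)‖ ≤ G_E(2σ − 1)`**, `σ = Re s > 1`: `‖∫_E max(1,‖X‖)^{−2(s−½)} ψ(Xξ) dμ_E‖ ≤ ∫_E max(1,‖X‖)^{−(2σ−1)} dμ_E` (`|ψ| = 1`, ★ majorant). [cite: Tate1950, §2.5] -/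
theorem norm_integral_weight_mul_addChar_le (ψ : AddChar E Circle) (ξ : E) {s : ℂ} (hs : 1 < s.re) :
    ‖∫ X, (((max 1 ((normAbs E X : ℝ≥0) : ℝ) : ℝ) : ℂ) ^ (-(2 * (s - 1 / 2)))) * ((ψ (X * ξ) : Circle) : ℂ) ∂μE‖ ≤
      ∫ X, (max 1 ((normAbs E X : ℝ≥0) : ℝ)) ^ (-(2 * s.re - 1)) ∂μE := by
  refine norm_integral_le_of_norm_le (integrable_max_one_normAbs_rpow_neg μE (by linarith : 1 < 2 * s.re - 1))
    (Filter.Eventually.of_forall fun X => ?_)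
  rw [norm_mul, Circle.norm_coe, mul_one, norm_max_one_cpow_neg, (re_two_mul s).2]

/-- **THE TRIVIAL BOUND** (`q_E = q_F²`, every `ψ`, every `ξ`, `σ = Re s > 1`): `‖J(ξ, s)‖ ≤ ∫_E ∫_F max(1, ‖X‖_E, |t|_F)^{−2σ} dμ_F dμ_E` — the UNTWISTED inert local scalar of ★
(q10) FILE 2 (`= G_F(2σ)·G_E(2σ−1)`, ★ `integral_integral_inertCell_eq_prod`), uniformly in the frequency `ξ` (the W4₃ majorant on vertical strips).
[cite: Casselman1980, §3 Thm. 3.1] [cite: Tate1950, §2.5] [cite: Rogawski1990, §4.5 p. 45] -/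
theorem norm_integral_inertWhittaker_le (hq : residueFieldCard E = residueFieldCard F ^ 2) (ψ : AddChar E Circle) (ξ : E) {s : ℂ} (hs : 1 < s.re) :
    ‖∫ X, (∫ t, (((max 1 (max ((normAbs E X : ℝ≥0) : ℝ) ((normAbs F t : ℝ≥0) : ℝ)) : ℝ) : ℂ) ^ (-(2 * s))) ∂μF) * ((ψ (X * ξ) : Circle) : ℂ) ∂μE‖ ≤
      ∫ X, ∫ t, (max 1 (max ((normAbs E X : ℝ≥0) : ℝ) ((normAbs F t : ℝ≥0) : ℝ))) ^ (-(2 * s.re)) ∂μF ∂μE := by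
  rw [integral_inertWhittaker_eq_mul μF μE hq ψ ξ s, norm_mul, integral_integral_inertCell_eq_prod μF μE hq s.re]
  refine mul_le_mul (norm_integral_max_one_cpow_le μF (by linarith)) (norm_integral_weight_mul_addChar_le μE ψ ξ hs) (norm_nonneg _)
    (integral_nonneg fun t => Real.rpow_nonneg (le_trans zero_le_one (le_max_left _ _)) _)

/-- **THE TRIVIAL BOUND, CLOSED FORM** (`σ = Re s > 1`, `q = q_F`):
`‖J(ξ, s)‖ ≤ μ_F(𝒪_F) μ_E(𝒪_E) · (1 − q^{−2σ})(1 + q^{−(2σ−1)}) ∕ [(1 − q^{−(2σ−2)})(1 + q^{−(2σ−2)})]` (★ `integral_integral_inertCell_eq`). [cite: Rogawski1990, §4.5 p. 45] [cite: Casselman1980, §3 Thm. 3.1] -/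
theorem norm_integral_inertWhittaker_le_closedForm (hq : residueFieldCard E = residueFieldCard F ^ 2) (ψ : AddChar E Circle) (ξ : E) {s : ℂ} (hs : 1 < s.re) :
    ‖∫ X, (∫ t, (((max 1 (max ((normAbs E X : ℝ≥0) : ℝ) ((normAbs F t : ℝ≥0) : ℝ)) : ℝ) : ℂ) ^ (-(2 * s))) ∂μF) * ((ψ (X * ξ) : Circle) : ℂ) ∂μE‖ ≤
      μF.real (primePowBall F 0) * μE.real (primePowBall E 0) *
        ((1 - (residueFieldCard F : ℝ) ^ (-(2 * s.re))) * (1 + (residueFieldCard F : ℝ) ^ (-(2 * s.re - 1))) /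
          ((1 - (residueFieldCard F : ℝ) ^ (-(2 * s.re - 2))) * (1 + (residueFieldCard F : ℝ) ^ (-(2 * s.re - 2))))) := by
  rw [← integral_integral_inertCell_eq μF μE hq hs]
  exact norm_integral_inertWhittaker_le μF μE hq ψ ξ hs

/-! ## §6 Holomorphy on the window `{1 < Re s}` (there `J(ξ, ·)` agrees with an ENTIRE polynomial in `q^{−s}`) -/

omit [MeasurableSpace F] [BorelSpace F] [MeasurableSpace E] [BorelSpace E] in
/-- **The closed form of §3 is ENTIRE in `s`** (products and sums of `s ↦ q^{−(2s−a)}`). [cite: Casselman1980, §3] -/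
theorem differentiable_inertWhittakerClosedForm (M : ℂ) (n : ℕ) :
    Differentiable ℂ fun s : ℂ => M *
      ((1 - (residueFieldCard F : ℂ) ^ (-(2 * s))) * (1 + (residueFieldCard F : ℂ) ^ (-(2 * s - 1))) *
        ∑ k ∈ Finset.range (n + 1), ((residueFieldCard E : ℂ) ^ (-(2 * s - 1)) * (residueFieldCard E : ℂ)) ^ k) := by
  have hqF : (residueFieldCard F : ℂ) ≠ 0 := Nat.cast_ne_zero.2 (residueFieldCard_ne_zero F)
  have hqE : (residueFieldCard E : ℂ) ≠ 0 := Nat.cast_ne_zero.2 (residueFieldCard_ne_zero E)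
  have hlin : Differentiable ℂ fun s : ℂ => -(2 * s - 1) := ((differentiable_id.const_mul (2 : ℂ)).sub_const 1).neg
  have hc0 : Differentiable ℂ fun s : ℂ => (residueFieldCard F : ℂ) ^ (-(2 * s)) :=
    ((differentiable_id.const_mul (2 : ℂ)).neg).const_cpow (Or.inl hqF)
  have hc1 : Differentiable ℂ fun s : ℂ => (residueFieldCard F : ℂ) ^ (-(2 * s - 1)) := hlin.const_cpow (Or.inl hqF)
  have hc2 : Differentiable ℂ fun s : ℂ => (residueFieldCard E : ℂ) ^ (-(2 * s - 1)) := hlin.const_cpow (Or.inl hqE)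
  refine (differentiable_const M).mul ((((differentiable_const 1).sub hc0).mul ((differentiable_const 1).add hc1)).mul ?_)
  exact Differentiable.fun_sum fun k _ => (hc2.mul_const _).fun_pow k

/-- **`s ↦ J(ξ, s)` IS HOLOMORPHIC ON `{1 < Re s}`** for `ξ` in the shell `𝔭_E^{m+n} ∖ 𝔭_E^{m+n+1}` (`q_E = q_F²`, `ψ` continuous of conductor exponent `m`): there it agrees with the
entire closed form of §3. [cite: Casselman1980, §3 Thm. 3.1] [cite: Tate1950, §2.5] -/
theorem differentiableOn_integral_inertWhittaker (hq : residueFieldCard E = residueFieldCard F ^ 2) {ψ : AddChar E Circle} (hψ : Continuous ψ) {m : ℤ}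
    (hm : ψ.HasConductorExp m) {ξ : E} {n : ℕ} (hn : ξ ∈ primePowBall E (m + n)) (hn' : ξ ∉ primePowBall E (m + n + 1)) :
    DifferentiableOn ℂ (fun s : ℂ =>
      ∫ X, (∫ t, (((max 1 (max ((normAbs E X : ℝ≥0) : ℝ) ((normAbs F t : ℝ≥0) : ℝ)) : ℝ) : ℂ) ^ (-(2 * s))) ∂μF) * ((ψ (X * ξ) : Circle) : ℂ) ∂μE)
      {s : ℂ | 1 < s.re} := by
  refine ((differentiable_inertWhittakerClosedForm (E := E) (F := F)
    ((μF.real (primePowBall F 0) : ℂ) * (μE.real (primePowBall E 0) : ℂ)) n).differentiableOn).congr fun s hs => ?_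
  exact integral_inertWhittaker_eq_closedForm μF μE hq hψ hm hn hn' hs

/-- Outside `𝔭_E^m` the function `s ↦ J(ξ, s)` is identically `0` on `{1 < Re s}`, in particular holomorphic there. [cite: Tate1950, §2.5] -/
theorem differentiableOn_integral_inertWhittaker_of_not_mem (hq : residueFieldCard E = residueFieldCard F ^ 2) {ψ : AddChar E Circle} (hψ : Continuous ψ)
    {m : ℤ} (hm : ψ.HasConductorExp m) {ξ : E} (hξ : ξ ∉ primePowBall E m) :
    DifferentiableOn ℂ (fun s : ℂ =>
      ∫ X, (∫ t, (((max 1 (max ((normAbs E X : ℝ≥0) : ℝ) ((normAbs F t : ℝ≥0) : ℝ)) : ℝ) : ℂ) ^ (-(2 * s))) ∂μF) * ((ψ (X * ξ) : Circle) : ℂ) ∂μE)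
      {s : ℂ | 1 < s.re} :=
  (differentiableOn_const (0 : ℂ)).congr fun _ hs => integral_inertWhittaker_eq_zero_of_not_mem μF μE hq hψ hm hξ hs

end TwoLocalFields

end Summit.HodgeConjecture.HodgeConjecture.Cruxes.H413.K2E1FiniteWhittakerInertU3

end
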